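import Literature.NumberTheory.Automorphic.LocalConstants
import Literature.NumberTheory.GaloisRepresentations.WeilDeligneRepProofs
import HarnessLib

/-!
# Stub `stub_eulerFactor_ofSubrep_of_ker_le` for line `Sketch_18745_r1_k1` (crux stmt-Langlands-18745)

W2-E: the Euler factor `det(1 - T · ρ(Φ) | (ker N)^{I_F})` of a Weil–Deligne representation `r`
only sees a stable subspace `p` containing `ker N`: `(r|_p).eulerFactor = r.eulerFactor`.

Proof.  Under the inclusion `p ↪ V` the subspace `(ker N|_p)^{I_F} ≤ p` is exactly
`(ker N)^{I_F}` (`inertiaInvariantsKerN_ofSubrep_eq_comap`: membership is `N v = 0 ∧ ρ(I_F) v = v`,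
computed in `V`), and `(ker N)^{I_F} ≤ ker N ≤ p` (`inertiaInvariantsKerN_le_of_ker_le`).  The
resulting linear equivalence `(ker N|_p)^{I_F} ≃ (ker N)^{I_F}` (Mathlib `LinearEquiv.ofEq`,
`Submodule.comapSubtypeEquivOfLe`) conjugates the two restricted Frobenii — both are restrictions
of `ρ(Φ)` (`conj_restrictInertiaInvariantsKerN_ofSubrep`) — and the Euler factor is the reversed
characteristic polynomial of the restricted geometric Frobenius
(`WeilDeligneRep.eulerFactor_eq_reverse_charpoly`), a conjugation invariant
(Mathlib `LinearEquiv.charpoly_conj`).  Tate, *Number theoretic background* (Corvallis 1979),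
(4.1.6).  No definitions, no new hypotheses.
-/

set_option linter.dupNamespace false -- `Summit.Langlands.Langlands` is the mandated namespace

noncomputable section

open Module Literature.NumberTheory.Automorphic Literature.NumberTheory.GaloisRepresentations

namespace Summit.Langlands.Langlands.Theorems.ReciprocityRigidity

variable {F : Type} [Field F] [ValuativeRel F] [TopologicalSpace F] [IsNonarchimedeanLocalField F]

section General

variable {C : Type*} [Field C] [CharZero C] {V : Type*} [AddCommGroup V] [Module C V]

/-- For a sub-Weil–Deligne representation `r|_p` (`p` stable under `ρ(W_F)` and `N`), the
subspace `(ker N|_p)^{I_F}` of `p` is the preimage of `(ker N)^{I_F}` under the inclusion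
`p ↪ V`: both memberships read `N v = 0 ∧ ∀ u ∈ I_F, ρ(u) v = v` in `V`.
[cite: TateCorvallis1979, (4.1.6)] -/
theorem inertiaInvariantsKerN_ofSubrep_eq_comap (r : WeilDeligneRep F C V) (p : Submodule C V)
    (hp : r.IsSubrep p) :
    (r.ofSubrep p hp).inertiaInvariantsKerN = r.inertiaInvariantsKerN.comap p.subtype := by
  ext v
  simp only [WeilDeligneRep.mem_inertiaInvariantsKerN_iff, Submodule.mem_comap,
    Submodule.subtype_apply]
  have hN : ∀ x : p, (((r.ofSubrep p hp).N x : p) : V) = r.N x := fun _ => rfl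
  have hρ : ∀ (u : WeilGroup F) (x : p), (((r.ofSubrep p hp).ρ u x : p) : V) = r.ρ u x :=
    fun _ _ => rfl
  refine and_congr ?_ (forall₂_congr fun u _ => ?_)
  · rw [← Submodule.coe_eq_zero, hN]
  · rw [Subtype.ext_iff, hρ]

/-- `(ker N)^{I_F} ≤ ker N`, hence `(ker N)^{I_F} ≤ p` whenever `ker N ≤ p`.
[cite: TateCorvallis1979, (4.1.6)] -/
theorem inertiaInvariantsKerN_le_of_ker_le (r : WeilDeligneRep F C V) {p : Submodule C V}
    (hker : LinearMap.ker r.N ≤ p) : r.inertiaInvariantsKerN ≤ p :=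
  le_trans inf_le_left hker

/-- When `ker N ≤ p`, the identification `(ker N|_p)^{I_F} ≃ (ker N)^{I_F}` induced by the
inclusion `p ↪ V` (Mathlib `LinearEquiv.ofEq`, `Submodule.comapSubtypeEquivOfLe`) conjugates the
action of `w ∈ W_F` on `(ker N|_p)^{I_F}` to its action on `(ker N)^{I_F}`: both are restrictions
of `ρ(w)`. [cite: TateCorvallis1979, (4.1.6)] -/
theorem conj_restrictInertiaInvariantsKerN_ofSubrep (hn : absInertia_normal F)
    (r : WeilDeligneRep F C V) (p : Submodule C V) (hp : r.IsSubrep p)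
    (hker : LinearMap.ker r.N ≤ p) (w : WeilGroup F) :
    ((LinearEquiv.ofEq _ _ (inertiaInvariantsKerN_ofSubrep_eq_comap r p hp)).trans
        (Submodule.comapSubtypeEquivOfLe (inertiaInvariantsKerN_le_of_ker_le r hker))).conj
      ((r.ofSubrep p hp).restrictInertiaInvariantsKerN hn w) =
      r.restrictInertiaInvariantsKerN hn w := by
  refine LinearMap.ext fun v => Subtype.ext ?_
  rfl

end General

/-- **Stub W2-E: the Euler factor only sees a stable subspace containing `ker N`.**
For a Weil–Deligne representation `r` on a finite-dimensional complex space `V` and a subspace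
`p ≤ V` stable under `ρ(W_F)` and `N` with `ker N ≤ p`, the Euler factors
`det(1 - T · ρ(Φ) | (ker N)^{I_F})` of `r|_p` and of `r` coincide: `(ker N)^{I_F} ⊆ ker N ⊆ p`, so
the inclusion `p ↪ V` identifies `(ker N|_p)^{I_F}` with `(ker N)^{I_F}` compatibly with the
restricted geometric Frobenius (`conj_restrictInertiaInvariantsKerN_ofSubrep`), and the Euler
factor is the reversed characteristic polynomial of that Frobenius
(`WeilDeligneRep.eulerFactor_eq_reverse_charpoly`), a conjugation invariant
(`LinearEquiv.charpoly_conj`). [cite: TateCorvallis1979, (4.1.6)] -/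
theorem stub_eulerFactor_ofSubrep_of_ker_le (hn : absInertia_normal F)
    (hex : @exists_isFrobPow F _ _ _ _)
    {V : Type*} [AddCommGroup V] [Module ℂ V] [FiniteDimensional ℂ V]
    (r : WeilDeligneRep F ℂ V) (p : Submodule ℂ V) (hp : r.IsSubrep p)
    (hker : LinearMap.ker r.N ≤ p) :
    (r.ofSubrep p hp).eulerFactor hn hex = r.eulerFactor hn hex := by
  rw [(r.ofSubrep p hp).eulerFactor_eq_reverse_charpoly hn hex (WeilDeligneRep.deg_geomFrob' hex),
    r.eulerFactor_eq_reverse_charpoly hn hex (WeilDeligneRep.deg_geomFrob' hex),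
    ← conj_restrictInertiaInvariantsKerN_ofSubrep hn r p hp hker (WeilDeligneRep.geomFrob F hex),
    LinearEquiv.charpoly_conj]

end Summit.Langlands.Langlands.Theorems.ReciprocityRigidity
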